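import Summits.QuantumAdvantage.QuantumAdvantage.Theorems.HankelLiftBeyondRectanglesSuccessCalibration
import Summits.QuantumAdvantage.QuantumAdvantage.Theorems.HankelLiftBeyondRectanglesAntidiagonalSampling
import Summits.QuantumAdvantage.QuantumAdvantage.Theorems.HankelLiftHankelDiscrepancy
import Summits.QuantumAdvantage.QuantumAdvantage.Theorems.HankelLiftDiscToRules
import Summits.QuantumAdvantage.QuantumAdvantage.Theorems.HankelLiftLiouvilleSumMemBQP
import HarnessLib

/-!
# Route HankelLift, crux `BeyondRectangles` (stmt-QuantumAdvantage-18440): the crux, and the summit,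
# from the one open stub `LiouvilleBPPDark`

The registered line `birth` of the hypothesis-type crux `HankelLift.BeyondRectangles`
(`Cruxes/BeyondRectangles/Lines/birth.lean`, sha `f6a15a6c0aead5bb`) composes three stubs,
`BeyondRectangles_of stub_liouvilleBPPDark stub_antidiagonalSampling stub_successCalibration`.  Two of them are
now theorems of the tree — `stub_successCalibration` (`HankelLiftBeyondRectanglesSuccessCalibration.lean`) and
`stub_antidiagonalSampling` (`HankelLiftBeyondRectanglesAntidiagonalSampling.lean`) — so the crux BY NAME, and
with the route's proved items (`liouvilleSumMemBQP_proof`, `hankelDiscrepancy_proof`, `discToRules_proof`, via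
the route's deciding theorem `HankelLift.closes`) the summit statement itself, follow from the single lift-free
hypothesis `LiouvilleBPPDark` (`HankelLiftBeyondRectanglesDefs.lean`):

* `beyondRectangles_of_liouvilleBPPDark : LiouvilleBPPDark → HankelLift.BeyondRectangles` — the registered
  composition with stubs 2 and 3 discharged: given a PPT `A`, the sampler `B` tracks `A`'s pair correlation
  within `4ⁿ/30`; darkness of `B` infinitely often gives `|pairCorr A n| ≤ 4ⁿ/6 + 4ⁿ/30 = 4ⁿ/5` there (and
  `n ≥ 1`); calibration turns this into `successSum A n ≤ (3/5)·4ⁿ`; the constant rules are rectangle rules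
  with `k = 1 ≤ n²` and one of them agrees on `≥ 4ⁿ/2` pairs (`rectangleBaseline`), so
  `success ≤ 1/2 + 1/10 ≤ agreement + 1/10`;
* `quantumAdvantage_of_liouvilleBPPDark : LiouvilleBPPDark → QuantumAdvantage`.

So the route `HankelLift` is conditional-complete on ONE statement in print vocabulary: "no probabilistic
polynomial-time algorithm `1/6`-correlates with `λ(m + 2)` under the triangular law of `m = x + y`
(`x, y` uniform `n`-bit), for infinitely many `n`" — the randomized, average-case, i.o. variant of Pudlák's
"λ is pseudorandom against P" (bib: Pudlak2013Pseudorandomness, Def. 2), an OPEN hypothesis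
(`Literature.Barriers.QuantumAdvantage.SeparationPrerequisites` applies to it exactly as to the crux).

WHAT THIS IS NOT: no proof of `LiouvilleBPPDark`, of the crux, or of the summit; separation NOT moved.  The
hypothesis mentions neither pairs, nor rectangles, nor the language `L⁺`: the rectangle dressing, the margin
`1/10` and the sum-lift are bookkeeping and a true complexity reduction, now all in the kernel.
-/

-- the sub-problem namespace `Summit.QuantumAdvantage.QuantumAdvantage` repeats the summit name by design (D-0017)
set_option linter.dupNamespace false

noncomputable section

namespace Summit.QuantumAdvantage.QuantumAdvantage.Theorems.BeyondRectangles

-- Same scopes as the route file, so that the copied sub-terms of the crux elaborate to the very same terms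
-- (in particular the same `Decidable` instances inside `Finset.filter`), making `beyondRectangles_iff` an `Iff.rfl`.
open scoped BigOperators Topology Manifold Classical MeasureTheory ProbabilityTheory Matrix InnerProductSpace ComplexConjugate ContinuousMap
open Filter Set Function TopologicalSpace MeasureTheory
open Literature.QuantumAdvantage
open Literature.Computability.Complexity (RandAlg)
open Summit.QuantumAdvantage.QuantumAdvantage.Theses.HankelLift (BeyondRectangles LiouvilleSumMemBQP HankelDiscrepancy
  DiscToRules closes)

/-! ### The constant-rule baseline and the restatement (from the registered skeleton, proofs verbatim) -/

/-- **Constant rules are rectangle rules (the baseline).**  For `n ≥ 1` there is a product-partition rule with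
`k = 1 ≤ n²` labels a side agreeing with `[λ(x+y+2) = −1]` on at least half of `[2ⁿ]²`: the two constant rules
`g ≡ true`, `g ≡ false` partition the pairs between them, so one of them agrees on `≥ 4ⁿ/2`.
[cite: KushilevitzNisan1996, §1.2] -/
theorem rectangleBaseline (n : ℕ) (hn : 1 ≤ n) :
    ∃ k : ℕ, k ≤ n ^ 2 ∧ ∃ (a b : Fin (2 ^ n) → Fin k) (g : Fin k → Fin k → Bool),
      (4 : ℝ) ^ n ≤ 2 * (agreeCount n k a b g : ℝ) := by
  -- the label pattern
  let P : Fin (2 ^ n) × Fin (2 ^ n) → Bool := fun p =>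
    decide (ArithmeticFunction.liouville (p.1.val + p.2.val + 2) = -1)
  have hk : 1 ≤ n ^ 2 := Nat.one_le_pow _ _ hn
  -- the two constant rules partition the pairs
  have hpart : (Finset.univ.filter fun p => true = P p).card
      + (Finset.univ.filter fun p => false = P p).card = 4 ^ n := by
    have h1 : (Finset.univ.filter fun p : Fin (2 ^ n) × Fin (2 ^ n) => false = P p)
        = Finset.univ.filter fun p => ¬ (true = P p) := by
      refine Finset.filter_congr ?_
      intro p _
      cases P p <;> simp
    rw [h1, Finset.card_filter_add_card_filter_not, card_pairs]
  have hconst : ∀ c : Bool, agreeCount n 1 (fun _ => 0) (fun _ => 0) (fun _ _ => c)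
      = (Finset.univ.filter fun p => c = P p).card := fun c => rfl
  by_cases h : 4 ^ n ≤ 2 * (Finset.univ.filter fun p => true = P p).card
  · refine ⟨1, hk, fun _ => 0, fun _ => 0, fun _ _ => true, ?_⟩
    rw [hconst]
    exact_mod_cast h
  · refine ⟨1, hk, fun _ => 0, fun _ => 0, fun _ _ => false, ?_⟩
    rw [hconst]
    have h' : 4 ^ n ≤ 2 * (Finset.univ.filter fun p => false = P p).card := by omega
    exact_mod_cast h'

/-- The crux, restated over the named objects: `BeyondRectangles` is by `Iff.rfl` (ζ-reduction of its two
`let`s, β-reduction, and δ-unfolding of `enc`, `liftLang`, `successSum`, `agreeCount`) the statement that every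
PPT has, infinitely often, average success at most the agreement fraction of some rectangle rule with `k ≤ n²`
plus `1/10`. [folklore] -/
theorem beyondRectangles_iff :
    BeyondRectangles ↔
      ∀ A : RandAlg (List Bool) Bool, A.IsPolyTime id Computability.encodeBool →
        ∃ᶠ n : ℕ in Filter.atTop, ∃ k : ℕ, k ≤ n ^ 2 ∧
          ∃ (a b : Fin (2 ^ n) → Fin k) (g : Fin k → Fin k → Bool),
            successSum A n / ((Finset.univ : Finset (Fin (2 ^ n) × Fin (2 ^ n))).card : ℝ) ≤
              (agreeCount n k a b g : ℝ) / ((Finset.univ : Finset (Fin (2 ^ n) × Fin (2 ^ n))).card : ℝ)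
                + 1 / 10 :=
  Iff.rfl

/-! ### The crux and the summit from `LiouvilleBPPDark` -/

/-- **`BeyondRectangles` from lift-free Liouville darkness.**  The registered composition `BeyondRectangles_of`
of line `birth` with its two true stubs discharged (`stub_antidiagonalSampling`, `stub_successCalibration`):
given a PPT `A`, the antidiagonal sampler `B` (PPT) has `|pairCorr A n − sumCorr B n| ≤ 4ⁿ/30` at every level;
`LiouvilleBPPDark` applied to `B` yields infinitely many `n ≥ 1` with `|sumCorr B n| ≤ 4ⁿ/6`, hence
`|pairCorr A n| ≤ 4ⁿ/5`, so `successSum A n ≤ (3/5)·4ⁿ` by calibration, and the constant-rule baseline gives a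
rectangle rule with `k ≤ n²` agreeing on `≥ 4ⁿ/2` pairs: `success ≤ 1/2 + 1/10 ≤ agreement + 1/10`.
[cite: BogdanovTrevisan2006, Def. 2.13] -/
theorem beyondRectangles_of_liouvilleBPPDark (h₁ : LiouvilleBPPDark) : BeyondRectangles := by
  refine beyondRectangles_iff.2 fun A hA => ?_
  obtain ⟨B, hB, hAB⟩ := stub_antidiagonalSampling A hA
  refine ((h₁ B hB).and_eventually (Filter.eventually_ge_atTop 1)).mono ?_
  rintro n ⟨hdark, hn⟩
  obtain ⟨k, hk, a, b, g, hbase⟩ := rectangleBaseline n hn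
  refine ⟨k, hk, a, b, g, ?_⟩
  have hcard : ((Finset.univ : Finset (Fin (2 ^ n) × Fin (2 ^ n))).card : ℝ) = (4 : ℝ) ^ n := by
    rw [card_pairs]; push_cast; rfl
  have hpos : (0 : ℝ) < (4 : ℝ) ^ n := by positivity
  have hcorr : |pairCorr A n| ≤ (4 : ℝ) ^ n / 5 := by
    have htri := abs_sub_abs_le_abs_sub (pairCorr A n) (sumCorr B n)
    have hn' := hAB n
    linarith
  have hsucc : successSum A n ≤ 3 / 5 * (4 : ℝ) ^ n := by
    have hcal := stub_successCalibration A n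
    have habs := neg_abs_le (pairCorr A n)
    linarith
  rw [hcard]
  have h1 : successSum A n / (4 : ℝ) ^ n ≤ 3 / 5 := by
    rw [div_le_iff₀ hpos]; linarith
  have h2 : (1 : ℝ) / 2 ≤ (agreeCount n k a b g : ℝ) / (4 : ℝ) ^ n := by
    rw [le_div_iff₀ hpos]; linarith
  linarith

/-- **The summit from lift-free Liouville darkness.**  The route's deciding theorem `HankelLift.closes` with
its three theorem-side binders discharged by the tree (`liouvilleSumMemBQP_proof` — Shor + a classical wrap;
`hankelDiscrepancy_proof` — Davenport's uniform bound + Parseval; `discToRules_proof` — cell-by-cell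
discrepancy) and the hypothesis-side binder `BeyondRectangles` supplied by
`beyondRectangles_of_liouvilleBPPDark`.  CONDITIONAL on the open hypothesis `LiouvilleBPPDark`; nothing
unconditional about `BPP` is claimed. [cite: AroraBarak2009, Thm. 7.10] -/
theorem quantumAdvantage_of_liouvilleBPPDark (h : LiouvilleBPPDark) : QuantumAdvantage :=
  closes HankelLift.liouvilleSumMemBQP_proof hankelDiscrepancy_proof discToRules_proof
    (beyondRectangles_of_liouvilleBPPDark h)

end Summit.QuantumAdvantage.QuantumAdvantage.Theorems.BeyondRectangles

end
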